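import Literature.AlgebraicGeometry.Milne1999.CMTypeSubquotients
import Literature.AlgebraicGeometry.Motives.AbelianVarietyImageSimpleProofs
import HarnessLib

/-!
# Non-zero homomorphisms to or from a simple abelian variety transport CM-type; `Hom(A, B) = 0` between CM and simple non-CM

Milne, *Lefschetz motives and the Tate conjecture*, Compositio Math. 117 (1999), §2 p. 54: «an
arbitrary Abelian variety over `C` is said to be of CM-type if all its simple isogeny factors are of
CM-type»; Mumford, *Abelian Varieties* (1970), §19, Thm. 1 and Cor. 1–2 (pp. 173–174): images of
homomorphisms are abelian subvarieties, Poincaré's complete reducibility, uniqueness of the simple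
isogeny factors, and «a non-zero homomorphism between simple abelian varieties is an isogeny».
Consequently a simple abelian variety `B` admitting a NON-ZERO homomorphism to or from an abelian
variety `A` of CM-type is a simple isogeny factor of `A`, hence of CM-type; equivalently,
`Hom(A, B) = 0 = Hom(B, A)` whenever `A` is of CM-type and the simple `B` is not (the hypothesis
«`Hom(A, C) = 0`» / «no isogeny factor of CM-type» in Moonen–Zarhin, *Hodge classes on abelian
varieties of low dimension*, Math. Ann. 315 (1999), §3 (3.1) and Thm. (0.1), is of this kind).

This file PROVES these statements for the tree's étale rendering `Milne1999.IsOfCMType` of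
«of CM-type», over `ℂ`, from `Milne1999/CMTypeSubquotients` (abelian subvarieties and quotients of
CM abelian varieties are CM) and `Motives/AbelianVarietyImageSimpleProofs`:

* `AbelianVariety.dim_kerComponent_eq_zero_of_isSimple`, `dim_image_eq_of_isSimple`,
  `isIsogeny_toImage_of_isSimple` — **a non-zero homomorphism `f : X → Y` out of a SIMPLE abelian
  variety is an isogeny onto its image** (`(Ker f)⁰_red ↪ X` is a proper abelian subvariety since
  `dim (im f) > 0`, hence zero-dimensional by simplicity; `dim X = dim (im f) + dim (Ker f)⁰`);
* `IsOfCMType.of_ne_zero_hom_from_isSimple` — `B` of CM-type, `A` simple, `f : A → B` non-zero ⟹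
  `A` of CM-type (`A → im f` is an isogeny onto an abelian subvariety of `B`);
* `IsOfCMType.of_ne_zero_hom_to_isSimple` — `A` of CM-type, `B` simple, `f : A → B` non-zero ⟹
  `B` of CM-type (`f` is surjective, `AbelianVariety.surjective_of_isSimple`);
* `hom_eq_zero_of_isOfCMType_of_isSimple`, `hom_eq_zero_of_isSimple_of_isOfCMType`,
  `subsingleton_hom_…` — **`Hom(A, B) = 0` and `Hom(B, A) = 0` for `A` of CM-type and `B` simple not
  of CM-type**;
* the elliptic-curve instances (`dim E = 1` is simple, `isSimple_of_dim_le_one`):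
  `hom_eq_zero_of_isOfCMType_of_not_isOfCMType_of_dim_eq_one` (every homomorphism from a CM abelian
  variety to a non-CM elliptic curve is zero) and `hom_eq_zero_of_not_isOfCMType_of_dim_eq_one_of_isOfCMType`.

No definition, no named fact: theorems only.

## References
* [Milne1999] J. S. Milne, Compositio Math. 117 (1999), §2 p. 54.
* [MumfordAV1970] D. Mumford, *Abelian Varieties* (1970), §19 Thm. 1, Cor. 1–2 (pp. 173–174).
* [LangeBirkenhake1992] H. Lange, Ch. Birkenhake, *Complex Abelian Varieties* (1992), Prop. 1.1.10–1.1.12.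
* [MoonenZarhin1999LowDim] B. Moonen, Yu. Zarhin, Math. Ann. 315 (1999), §3 (3.1).
* [Deligne1982HodgeCycles] P. Deligne, LNM 900 (1982), §5 p. 63.
-/

noncomputable section

open CategoryTheory CategoryTheory.Limits

/-! ## §1 A non-zero homomorphism out of a simple abelian variety is an isogeny onto its image -/

namespace Literature.AlgebraicGeometry.Motives.AbelianVariety

open _root_.AlgebraicGeometry Literature.AlgebraicGeometry.HodgeTheory

variable {X Y : AbelianVariety ℂ}

/-- For a non-zero homomorphism `f : X → Y` out of a SIMPLE complex abelian variety, the identity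
component `(Ker f)⁰_red` of the kernel is zero-dimensional: it is an abelian subvariety of `X`
(`kerComponentι`) of dimension `dim X - dim (im f) < dim X` (`dim_eq_dim_image_add_dim_kerComponent`,
`dim_image_pos`), so simplicity leaves only dimension `0`. [cite: MumfordAV1970, §19 Cor. 2 of Thm. 1 (proof)]
[cite: LangeBirkenhake1992, Prop. 1.1.10 and Prop. 1.1.12] -/
theorem dim_kerComponent_eq_zero_of_isSimple (hX : IsSimple X) (f : X ⟶ Y) (hf : f ≠ 0) :
    (kerComponent f).dim = 0 := by
  have hsum := dim_eq_dim_image_add_dim_kerComponent f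
  have hpos := dim_image_pos f hf
  by_contra h0
  exact hX (kerComponent f) (kerComponentι f) (isClosedImmersion_toSchemeHom_kerComponentι f)
    (Nat.pos_of_ne_zero h0) (by omega)

/-- For a non-zero homomorphism `f : X → Y` out of a simple complex abelian variety,
`dim (im f) = dim X`. [cite: MumfordAV1970, §19 Cor. 2 of Thm. 1 (proof)]
[cite: LangeBirkenhake1992, Prop. 1.1.10 and Prop. 1.1.12] -/
theorem dim_image_eq_of_isSimple (hX : IsSimple X) (f : X ⟶ Y) (hf : f ≠ 0) :
    (image f).dim = X.dim := by
  have hsum := dim_eq_dim_image_add_dim_kerComponent f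
  rw [dim_kerComponent_eq_zero_of_isSimple hX f hf] at hsum
  omega

/-- **A non-zero homomorphism out of a simple abelian variety is an isogeny onto its image**:
`X ↠ im f` is surjective between abelian varieties of the same dimension
(`isIsogeny_of_surjective_of_dim_eq`).  (Mumford §19, proof of Cor. 2 of Thm. 1: the kernel of a
non-zero homomorphism out of a simple abelian variety is finite.) [cite: MumfordAV1970, §19 Cor. 2 of Thm. 1 (proof)]
[cite: LangeBirkenhake1992, Prop. 1.1.12] -/
theorem isIsogeny_toImage_of_isSimple (hX : IsSimple X) (f : X ⟶ Y) (hf : f ≠ 0) :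
    IsIsogeny (toImage f) :=
  isIsogeny_of_surjective_of_dim_eq (toImage f) (dim_image_eq_of_isSimple hX f hf).symm

/-- A simple abelian variety with a non-zero homomorphism `f : X → Y` is isogenous to an abelian
subvariety of `Y`, namely `im f`. [cite: MumfordAV1970, §19 Thm. 1 and Cor. 2 (pp. 173–174)] -/
theorem isIsogenous_image_of_isSimple (hX : IsSimple X) (f : X ⟶ Y) (hf : f ≠ 0) :
    IsIsogenous X (image f) :=
  ⟨toImage f, isIsogeny_toImage_of_isSimple hX f hf⟩

end Literature.AlgebraicGeometry.Motives.AbelianVariety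

/-! ## §2 CM-type along non-zero homomorphisms to or from a simple abelian variety -/

namespace Literature.AlgebraicGeometry.Milne1999

open _root_.AlgebraicGeometry
open Literature.AlgebraicGeometry.Motives Literature.AlgebraicGeometry.Motives.AbelianVariety

variable {A B : AbelianVariety ℂ}

/-- **A simple abelian variety with a non-zero homomorphism INTO a CM abelian variety is of
CM-type**: for `B` of CM-type, `A` simple and `f : A → B` non-zero, `A → im f` is an isogeny
(`isIsogeny_toImage_of_isSimple`) onto an abelian subvariety of `B`, which is of CM-type
(`IsOfCMType.image_of_target`), and CM-type is an isogeny invariant (`IsOfCMType.of_isIsogeny'`).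
(Milne 1999 p. 54: `A` is then a simple isogeny factor of `B`.) [cite: Milne1999, §2 p. 54]
[cite: MumfordAV1970, §19 Thm. 1 and Cor. 1–2 (pp. 173–174)] -/
theorem IsOfCMType.of_ne_zero_hom_from_isSimple (hB : IsOfCMType B) (hA : IsSimple A) (f : A ⟶ B)
    (hf : f ≠ 0) : IsOfCMType A :=
  (hB.image_of_target f).of_isIsogeny' (isIsogeny_toImage_of_isSimple hA f hf)

/-- **A simple abelian variety with a non-zero homomorphism FROM a CM abelian variety is of
CM-type**: for `A` of CM-type, `B` simple and `f : A → B` non-zero, `f` is surjective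
(`AbelianVariety.surjective_of_isSimple`, Mumford §19 Cor. 2) and quotients of CM abelian varieties
are CM (`IsOfCMType.of_surjective_hom`). [cite: Milne1999, §2 p. 54]
[cite: MumfordAV1970, §19 Cor. 2 of Thm. 1] -/
theorem IsOfCMType.of_ne_zero_hom_to_isSimple (hA : IsOfCMType A) (hB : IsSimple B) (f : A ⟶ B)
    (hf : f ≠ 0) : IsOfCMType B := by
  haveI := surjective_of_isSimple f hB hf
  exact hA.of_surjective_hom f

/-- **`Hom(A, B) = 0` for `A` of CM-type and `B` simple, not of CM-type.** [cite: Milne1999, §2 p. 54]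
[cite: MumfordAV1970, §19 Cor. 2 of Thm. 1] -/
theorem hom_eq_zero_of_isOfCMType_of_isSimple (hA : IsOfCMType A) (hB : IsSimple B)
    (hB' : ¬ IsOfCMType B) (f : A ⟶ B) : f = 0 := by
  by_contra hf
  exact hB' (hA.of_ne_zero_hom_to_isSimple hB f hf)

/-- **`Hom(B, A) = 0` for `B` simple, not of CM-type, and `A` of CM-type.** [cite: Milne1999, §2 p. 54]
[cite: MumfordAV1970, §19 Thm. 1 and Cor. 1–2 (pp. 173–174)] -/
theorem hom_eq_zero_of_isSimple_of_isOfCMType (hB : IsSimple B) (hB' : ¬ IsOfCMType B)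
    (hA : IsOfCMType A) (f : B ⟶ A) : f = 0 := by
  by_contra hf
  exact hB' (hA.of_ne_zero_hom_from_isSimple hB f hf)

/-- `Hom(A, B)` is trivial (a subsingleton) for `A` of CM-type and `B` simple non-CM.
[cite: Milne1999, §2 p. 54] -/
theorem subsingleton_hom_of_isOfCMType_of_isSimple (hA : IsOfCMType A) (hB : IsSimple B)
    (hB' : ¬ IsOfCMType B) : Subsingleton (A ⟶ B) :=
  ⟨fun f g => by
    rw [hom_eq_zero_of_isOfCMType_of_isSimple hA hB hB' f,
      hom_eq_zero_of_isOfCMType_of_isSimple hA hB hB' g]⟩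

/-- `Hom(B, A)` is trivial (a subsingleton) for `B` simple non-CM and `A` of CM-type.
[cite: Milne1999, §2 p. 54] -/
theorem subsingleton_hom_of_isSimple_of_isOfCMType (hB : IsSimple B) (hB' : ¬ IsOfCMType B)
    (hA : IsOfCMType A) : Subsingleton (B ⟶ A) :=
  ⟨fun f g => by
    rw [hom_eq_zero_of_isSimple_of_isOfCMType hB hB' hA f,
      hom_eq_zero_of_isSimple_of_isOfCMType hB hB' hA g]⟩

/-! ## §3 Elliptic curves -/

/-- **Every homomorphism from a CM abelian variety to a non-CM elliptic curve is zero** (an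
elliptic curve, `dim E = 1`, is simple: `isSimple_of_dim_le_one`).  This is the vanishing
`Hom(A, C) = 0` behind Moonen–Zarhin's §3 (3.1) for a CM `A` and a non-CM curve `C`.
[cite: Milne1999, §2 p. 54] [cite: MoonenZarhin1999LowDim, §3 (3.1)] -/
theorem hom_eq_zero_of_isOfCMType_of_not_isOfCMType_of_dim_eq_one {E : AbelianVariety ℂ}
    (hA : IsOfCMType A) (hE : E.dim = 1) (hE' : ¬ IsOfCMType E) (f : A ⟶ E) : f = 0 :=
  hom_eq_zero_of_isOfCMType_of_isSimple hA (isSimple_of_dim_le_one hE.le) hE' f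

/-- **Every homomorphism from a non-CM elliptic curve to a CM abelian variety is zero.**
[cite: Milne1999, §2 p. 54] [cite: MoonenZarhin1999LowDim, §3 (3.1)] -/
theorem hom_eq_zero_of_not_isOfCMType_of_dim_eq_one_of_isOfCMType {E : AbelianVariety ℂ}
    (hE : E.dim = 1) (hE' : ¬ IsOfCMType E) (hA : IsOfCMType A) (f : E ⟶ A) : f = 0 :=
  hom_eq_zero_of_isSimple_of_isOfCMType (isSimple_of_dim_le_one hE.le) hE' hA f

end Literature.AlgebraicGeometry.Milne1999
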